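import Literature.AlgebraicGeometry.HodgeTheory.BettiKunnethPiecesPrimitiveEvenCount
import Literature.AlgebraicGeometry.HodgeTheory.BettiPrimitiveCohomologyHodgeNumbers
import Literature.AlgebraicGeometry.HodgeTheory.BettiUniverseCMAction
import Literature.AlgebraicGeometry.HodgeTheory.ClassesSupportedOnComplexification
import Literature.AlgebraicGeometry.HodgeTheory.HodgeTypeConjugation
import Literature.AlgebraicGeometry.HodgeTheory.HodgeStructureOfHodgeModelIntegerTypeShift
import Literature.AlgebraicGeometry.Motives.HodgeTensorHodgeNumberProofs
import Literature.AlgebraicGeometry.Motives.HodgeStructureHodgeClassesFinrank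
import HarnessLib

/-!
# The Hodge numbers of the primitive cohomology `Pᵃ(X)` as a sub-`ℚ`-Hodge structure: `h^{s,t}(Pᵃ(X)) = dim (H^{s,t} ∩ Pᵃ_ℂ) = h^{s,t}(X) − h^{s−1,t−1}(X)`, and the NUMERICAL
# vanishing of the biprimitive Hodge classes of `Hⁱ(Y) ⊗ Hʲ(Z)` (Voisin I §6.2.3 Rem. 6.27, §6.3.2 proof of Thm. 6.33, §7.3.1 Def. 7.24, §11.3.3; Deligne II 1.1.12, 1.2.5)

Family `hodge`, lane `lit-hodgefound` (Track 2 foundations library; Layers A1/A4), layer `Literature/AlgebraicGeometry/HodgeTheory`.  THEOREMS ONLY (no definition, no named fact,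
no instance, no notation; D-0026 net debt `0`).  Prover seat `lit-hodgefound-p21` (generation 38, row g38-#9), sequel of g38-#7 `BettiPrimitiveSubHodgeStructure` (the sub-Hodge structure
`Pᵃ(X) = BettiUniverse.primitiveHodge`), g38-#8 `BettiKunnethPiecesPrimitiveEvenCount`, and of p29's `BettiPrimitiveCohomologyHodgeNumbers` (the primitive Hodge numbers
`dim (H^{s,t}_A ∩ Pᵃ_ℂ) = h^{s,t} − h^{s−1,t−1}` on the COMPLEX carrier, for the complexified Kähler class `H_η = η ⊗ 1`).  This file identifies the two: the abstract Hodge numbers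
`HodgeStructure.hodgeNumber` of the `ℚ`-Hodge structure `Pᵃ(X)` ARE p29's primitive Hodge numbers — so every numerical statement of that file is now a statement about an honest Hodge
structure, usable by the lane's `Hom_HS` / Hodge-class machinery — and draws the numerical consequence for products: the biprimitive Hodge classes of a Künneth piece vanish as soon as
the relevant products of primitive Hodge numbers do.

THE MATHEMATICS.  (1) `Θ : ℂ ⊗_ℚ Hᵃ(X(ℂ);ℚ) ⥲ Hᵃ(X(ℂ);ℂ)` carries `Pᵃ(η) ⊗ ℂ` onto `Pᵃ(η ⊗ 1)`: `Pᵃ = ker L^{n−a+1}`, kernels commute with the flat base change, and `Θ ∘ (L_η ⊗ ℂ) = L_{η⊗1} ∘ Θ`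
(«The Lefschetz decomposition is also valid for the cohomology with complex coefficients», Rem. 6.27).  (2) For a sub-Hodge structure `W ⊆ V`, `h^{s,t}(W) = dim (W_ℂ ∩ V^{s,t})` (Def. 7.24,
the tree's `SubHodgeStructure.hodgeNumber_eq_finrank_inf`), and `V^{s,t} = Θ⁻¹(H^{s,t})` model-free (the tree's `BettiUniverse.mem_hodge_piece_iff`); hence
`h^{s,t}(Pᵃ(X)) = dim_ℂ (H^{s,t}_A ∩ Pᵃ_ℂ)` for every Hodge model `A`, `= h^{s,t}(Hᵃ(X)) − [0 < s ∧ 0 < t] h^{s−1,t−1}(H^{a−2}(X))` (`a ≤ n`; proof of Thm. 6.33), with the edge, symmetry and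
degree-`2` specialisations, and `h^{p,q}(Pᵃ(X)) = 0` off `0 ≤ p, q`, `p + q = a`.  (3) `dim_ℚ Hdg^c ≤ h^{c,c}` and `h^{c,c}(Pⁱ ⊗ Pʲ) = Σ_{a,b} h^{a,b}(Pⁱ) h^{c−a,c−b}(Pʲ)` (Deligne II 1.1.12,
the tree's `hodgeNumber_tensor_holds`): if all these products vanish, `Pⁱ(Y) ⊗ Pʲ(Z)` has no Hodge class of level `c`, so (g38-#7) every biprimitive Hodge class of `Hⁱ(Y) ⊗ Hʲ(Z)`
vanishes.  (4) Worked shape: **`HC(S × T)` for a surface `S` and a threefold `T` with `q(S) · h^{2,1}_prim(T) = 0` and `dim Hom_HS(P²(S), P²(T)) ≤ ρ₀(S) ρ₀(T)`** — the piece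
`H¹(S) ⊗ H³(T)` has `h^{2,2}(H¹(S) ⊗ P³(T)) = 2 q(S) h^{2,1}_prim(T)`, the piece `H² ⊗ H²` is counted on `P²(S) ⊗ P²(T)` (g38-#8), the rest is hard Lefschetz and `HC` in dimension `≤ 3`.

THE PRINTS.  C. Voisin (2002) [VoisinHodgeI2002] §6.2.3 Def. 6.24, Cor. 6.26, Rem. 6.27 (held text `book:voisin2002-hodge-theory-complex-algebraic-geometry-i` PDF p0126); §6.3.2 proof of
Thm. 6.33 («h^{a,b}_prim = h^{a,b} − h^{a−1,b−1}»); §7.1.1 Def. 7.4; §7.1.2; §7.3.1 Def. 7.24; §11.3.1 Thm. 11.30; §11.3.3 Thm. 11.38–11.40, Lemma 11.41, p. 287.  P. Deligne (1971)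
[DeligneHodgeII1971] 1.1.12, 1.2.5.  B. van Geemen (1994) [vanGeemen1994HodgeAV] 6.6–6.7 (`dim B ≤ h^{p,p}`).  C. Voisin (2003) [VoisinHodgeII2003] §9.2.4 Prop. 9.20.  P. Deligne (2000)
[Deligne2000] §1.  A. Hatcher (2002) [HatcherAT2002] §3.3 Thm. 3.26.

WHAT IS PROVED.
* §1 `KaehlerRationalDatum.ofRatClassBaseChange_baseChange_lefschetzPowTo` (`Θ ∘ (Lʳ_η ⊗ ℂ) = Lʳ_{η⊗1} ∘ Θ`), **`KaehlerRationalDatum.mem_baseChange_primitiveClasses_iff`**,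
  **`KaehlerRationalDatum.map_ofRatClassBaseChangeEquiv_baseChange_primitiveClasses`** (`Θ(Pᵃ(η) ⊗ ℂ) = Pᵃ(η ⊗ 1)`).
* §2 **`BettiUniverse.hodgeNumber_primitiveHodge_eq_finrank_typePiece_inf`** (`h^{s,t}(Pᵃ(X)) = dim_ℂ (H^{s,t}_A ∩ Pᵃ_ℂ)`, any model `A`), **`BettiUniverse.hodgeNumber_primitiveHodge_eq_sub`**
  (the difference formula), `…_add_hodgeNumber`, `…_zero_left`, `…_zero_right`, `…_of_le_one`, `…_symm`, `…_two_one_one_add_one` (`h^{1,1}(P²) + 1 = h^{1,1}`), `…_two_two_zero`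
  (`h^{2,0}(P²) = p_g`), **`BettiUniverse.hodgeNumber_primitiveHodge_eq_zero_of_not`** (vanishing off `0 ≤ p, q`, `p + q = a`).
* §3 **`BettiUniverse.hodgeClasses_primitive_tensor_eq_bot_of_forall_hodgeNumber_mul_eq_zero`**, **`BettiUniverse.eq_zero_of_biprimitive_of_forall_hodgeNumber_mul_eq_zero`**.
* §4 **`BettiUniverse.hodgeConjectureFor_surface_tensor_threefold_of_hodgeNumber_of_finrank_hom_le`** (displayed above).
* §5 (rider g38-#10) **`BettiUniverse.subsingleton_hom_primitive_tateTwist_of_forall_hodgeNumber_mul_eq_zero`** (`Hom_HS(Pⁱ(Y), Pʲ(Z)(s)) = 0` numerically) and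
  **`BettiUniverse.hodgeConjectureFor_tensor_threefolds_of_hodgeNumber_of_finrank_hom_le`**: `HC(T × T')` for two threefolds from `q(T) h^{2,1}_prim(T') = 0`, `q(T') h^{2,1}_prim(T) = 0`,
  `h^{3,0}(T) h^{3,0}(T') = 0`, `h^{2,1}_prim(T) h^{2,1}_prim(T') = 0` and `dim Hom_HS(P²(T), P²(T')) ≤ ρ₀(T) ρ₀(T')`.

## References
* [VoisinHodgeI2002] C. Voisin, *Hodge Theory and Complex Algebraic Geometry I* (2002) — §6.2.3 Def. 6.24, Cor. 6.26, Rem. 6.27; §6.3.2 proof of Thm. 6.33; §7.1.1 Def. 7.4; §7.1.2;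
  §7.3.1 Def. 7.24; §11.3.1 Thm. 11.30; §11.3.3 Thm. 11.38–11.40, Lemma 11.41, p. 287.
* [DeligneHodgeII1971] P. Deligne, *Théorie de Hodge II*, Publ. Math. IHÉS 40 (1971) — 1.1.12, 1.2.5.
* [vanGeemen1994HodgeAV] B. van Geemen, *An introduction to the Hodge conjecture for abelian varieties* (1994) — 6.6–6.7.
* [VoisinHodgeII2003] C. Voisin, *Hodge Theory and Complex Algebraic Geometry II* (2003) — §9.2.4 Prop. 9.20.
* [Deligne2000] P. Deligne, *The Hodge conjecture* (Clay, 2000) — §1.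
* [HatcherAT2002] A. Hatcher, *Algebraic Topology* (2002) — §3.3 Thm. 3.26.

## Provenance
Lane `lit-hodgefound` (Hodge path, Track 2), prover seat `lit-hodgefound-p21` (generation 38), self-proposed row g38-#9 (sequel of g38-#7/#8 and of p29's `BettiPrimitiveCohomologyHodgeNumbers`).
-/

noncomputable section

open scoped TensorProduct
open CategoryTheory MonoidalCategory Module Finset
open Literature.AlgebraicTopology.SingularHomology
open Literature.Geometry.Kaehler

namespace Literature.AlgebraicGeometry.HodgeTheory

open Literature.AlgebraicGeometry.Motives
open Literature.AlgebraicGeometry.Motives.HodgeStructure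

variable {n d : ℕ} {X : SchemeOver ℂ}

/-! ### §1 The primitive classes complexify to the primitive classes: `Θ(Pᵃ_ℚ ⊗ ℂ) = Pᵃ_ℂ` -/

section BaseChange

/-- `Θ ∘ (Lʳ_η ⊗ ℂ) = Lʳ_{η ⊗ 1} ∘ Θ` on `ℂ ⊗_ℚ Hᵃ(X(ℂ); ℚ)` (`Θ = ofRatClassBaseChange`). [cite: VoisinHodgeI2002, §7.1.2] -/
theorem KaehlerRationalDatum.ofRatClassBaseChange_baseChange_lefschetzPowTo (D : KaehlerRationalDatum n X) (r a l : ℕ) (h : a + 2 * r = l)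
    (x : ℂ ⊗[ℚ] bettiCohomology X a) :
    ofRatClassBaseChange (ComplexPoints X) l ((lefschetzPowTo D.η r a l h).baseChange ℂ x) =
      lefschetzPowTo D.Hη r a l h (ofRatClassBaseChange (ComplexPoints X) a x) := by
  induction x using TensorProduct.induction_on with
  | zero => rw [map_zero, map_zero, map_zero, map_zero]
  | tmul c u =>
    rw [LinearMap.baseChange_tmul, ofRatClassBaseChange_tmul, ofRatClassBaseChange_tmul, map_smul, D.ofRatClass_lefschetzPowTo r a l h u]
  | add x y hx hy => rw [map_add, map_add, hx, hy, map_add, map_add]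

/-- **`x ∈ Pᵃ(η) ⊗ ℂ ⟺ Θ x ∈ Pᵃ(η ⊗ 1)`**: the rational primitive cohomology complexifies onto the complex primitive cohomology of the Kähler class `H_η = η ⊗ 1`
(kernels commute with the flat base change `ℚ → ℂ`, and `Θ` intertwines `L_η ⊗ ℂ` with `L_{H_η}`). [cite: VoisinHodgeI2002, §6.2.3 Rem. 6.27 and §7.1.2] -/
theorem KaehlerRationalDatum.mem_baseChange_primitiveClasses_iff (D : KaehlerRationalDatum n X) (a : ℕ) (x : ℂ ⊗[ℚ] bettiCohomology X a) :
    x ∈ (primitiveClasses D.η n a).baseChange ℂ ↔ ofRatClassBaseChange (ComplexPoints X) a x ∈ primitiveClasses D.Hη n a := by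
  rcases le_or_gt a n with ha | hna
  · have hker : (LinearMap.ker (lefschetzPowTo D.η (n + 1 - a) a (a + 2 * (n + 1 - a)) rfl)).baseChange ℂ =
        LinearMap.ker ((lefschetzPowTo D.η (n + 1 - a) a (a + 2 * (n + 1 - a)) rfl).baseChange ℂ) :=
      (Module.Flat.ker_lTensor_eq ℂ ℂ (lefschetzPowTo D.η (n + 1 - a) a (a + 2 * (n + 1 - a)) rfl)).symm
    rw [primitiveClasses_eq_ker D.η n ha (show a + (n + 1 - a) = n + 1 by omega) rfl,
      primitiveClasses_eq_ker D.Hη n ha (show a + (n + 1 - a) = n + 1 by omega) rfl, hker, LinearMap.mem_ker, LinearMap.mem_ker,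
      ← D.ofRatClassBaseChange_baseChange_lefschetzPowTo, ← map_zero (ofRatClassBaseChange (ComplexPoints X) (a + 2 * (n + 1 - a)))]
    exact (ofRatClassBaseChange_injective _ _).eq_iff.symm
  · rw [primitiveClasses_eq_bot_of_lt D.η n hna, primitiveClasses_eq_bot_of_lt D.Hη n hna, Submodule.baseChange_bot, Submodule.mem_bot,
      Submodule.mem_bot, ← map_zero (ofRatClassBaseChange (ComplexPoints X) a)]
    exact (ofRatClassBaseChange_injective _ _).eq_iff.symm

/-- **`Θ(Pᵃ(η) ⊗ ℂ) = Pᵃ(η ⊗ 1)`** as `ℂ`-subspaces of `Hᵃ(X(ℂ); ℂ)` (`Θ` the comparison `ℂ ⊗_ℚ Hᵃ(X(ℂ);ℚ) ⥲ Hᵃ(X(ℂ);ℂ)`). [cite: VoisinHodgeI2002, §6.2.3 Rem. 6.27 and §7.1.2] -/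
theorem KaehlerRationalDatum.map_ofRatClassBaseChangeEquiv_baseChange_primitiveClasses (D : KaehlerRationalDatum n X) (hX : IsSmoothProjective n X) (a : ℕ) :
    ((primitiveClasses D.η n a).baseChange ℂ).map (ofRatClassBaseChangeEquiv hX a).toLinearMap = primitiveClasses D.Hη n a := by
  ext c
  rw [Submodule.mem_map_equiv, D.mem_baseChange_primitiveClasses_iff a, ← ofRatClassBaseChangeEquiv_apply hX a, LinearEquiv.apply_symm_apply]

end BaseChange

/-! ### §2 The Hodge numbers of the sub-Hodge structure `Pᵃ(X)`: `h^{s,t}(Pᵃ(X)) = dim (H^{s,t} ∩ Pᵃ_ℂ) = h^{s,t} − h^{s−1,t−1}` -/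

section HodgeNumbers

/-- **`h^{s,t}(Pᵃ(X)) = dim_ℂ (H^{s,t}_A ∩ Pᵃ_ℂ)`** (`s + t = a`, any Hodge model `A`): the Hodge number of the sub-`ℚ`-Hodge structure `Pᵃ(X) ⊆ Hᵃ(X)` (g38-#7) is the dimension of the
primitive classes of type `(s, t)` — `h^{s,t}` of a sub-Hodge structure is `dim (W_ℂ ∩ V^{s,t})` (Def. 7.24), `V^{s,t} = Θ⁻¹(H^{s,t})` model-free, and `Θ(Pᵃ_ℚ ⊗ ℂ) = Pᵃ_ℂ` (§1).
[cite: VoisinHodgeI2002, §7.3.1 Def. 7.24, §7.1.1 Def. 7.4, §6.2.3 Rem. 6.27] -/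
theorem BettiUniverse.hodgeNumber_primitiveHodge_eq_finrank_typePiece_inf (hHD : exists_isReal_hodgeModel) (hX : IsSmoothProjective n X) (D : KaehlerRationalDatum n X)
    (A : HodgeModel n X) {a s t : ℕ} (hst : s + t = a) :
    (BettiUniverse.primitiveHodge hHD hX D a).hodgeNumber s t =
      Module.finrank ℂ ↥(A.typePiece a ⟨(s, t), Finset.HasAntidiagonal.mem_antidiagonal.2 hst⟩ ⊓ primitiveClasses D.Hη n a) := by
  haveI := BettiUniverse.finite hX a
  rw [BettiUniverse.primitiveHodge_def, (BettiUniverse.primitiveSubHodge hHD hX D a).hodgeNumber_eq_finrank_inf (s : ℤ) (t : ℤ),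
    BettiUniverse.primitiveSubHodge_toSubmodule]
  -- transport along `Θ : ℂ ⊗_ℚ Hᵃ(X;ℚ) ≃ Hᵃ(X;ℂ)`
  have hmap : ((primitiveClasses D.η n a).baseChange ℂ ⊓ (BettiUniverse.hodge hHD hX a).piece s t).map (ofRatClassBaseChangeEquiv hX a).toLinearMap =
      A.typePiece a ⟨(s, t), Finset.HasAntidiagonal.mem_antidiagonal.2 hst⟩ ⊓ primitiveClasses D.Hη n a := by
    ext c
    rw [Submodule.mem_map_equiv, Submodule.mem_inf, Submodule.mem_inf, D.mem_baseChange_primitiveClasses_iff a,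
      BettiUniverse.mem_hodge_piece_iff hHD hodgePQ_independent_of_hodgeModel_holds hX hst, ← ofRatClassBaseChangeEquiv_apply hX a,
      LinearEquiv.apply_symm_apply, A.mem_typePiece_iff, ← isOfHodgeType_iff_mem_hodgePQ hX A c, and_comm]
  exact LinearEquiv.finrank_eq (((ofRatClassBaseChangeEquiv hX a).submoduleMap _).trans (LinearEquiv.ofEq _ _ hmap))

/-- **The Hodge numbers of `Pᵃ(X)` as differences, uniformly: `h^{s,t}(Pᵃ(X)) = h^{s,t}(Hᵃ(X)) − [0 < s ∧ 0 < t] · h^{s−1,t−1}(H^{a−2}(X))`** (`s + t = a ≤ n`; in `ℤ`).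
[cite: VoisinHodgeI2002, §6.3.2 proof of Thm. 6.33 («h^{a,b}_prim = h^{a,b} − h^{a−1,b−1}»), §6.2.3 Rem. 6.27, §7.3.1 Def. 7.24] -/
theorem BettiUniverse.hodgeNumber_primitiveHodge_eq_sub (hHD : exists_isReal_hodgeModel) (hX : IsSmoothProjective n X) (D : KaehlerRationalDatum n X) {a : ℕ} (ha : a ≤ n)
    {s t : ℕ} (hst : s + t = a) :
    ((BettiUniverse.primitiveHodge hHD hX D a).hodgeNumber s t : ℤ) =
      ((BettiUniverse.hodge hHD hX a).hodgeNumber s t : ℤ) -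
        if 0 < s ∧ 0 < t then ((BettiUniverse.hodge hHD hX (a - 2)).hodgeNumber (s - 1 : ℕ) (t - 1 : ℕ) : ℤ) else 0 := by
  rw [BettiUniverse.hodgeNumber_primitiveHodge_eq_finrank_typePiece_inf hHD hX D (BettiUniverse.realHodgeModel hHD hX) hst]
  exact D.finrank_typePiece_inf_primitiveClasses_eq_hodgeNumber_sub hHD hX (BettiUniverse.realHodgeModel hHD hX) ha ⟨(s, t), Finset.HasAntidiagonal.mem_antidiagonal.2 hst⟩

/-- **`h^{s+1,t+1}(Pᵃ(X)) + h^{s,t}(H^{a−2}(X)) = h^{s+1,t+1}(Hᵃ(X))`** (`s + t + 2 = a ≤ n`): the interior of the Hodge diamond. [cite: VoisinHodgeI2002, §6.3.2 proof of Thm. 6.33, §7.3.1 Def. 7.24] -/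
theorem BettiUniverse.hodgeNumber_primitiveHodge_add_hodgeNumber (hHD : exists_isReal_hodgeModel) (hX : IsSmoothProjective n X) (D : KaehlerRationalDatum n X) {s t a : ℕ}
    (hst : s + 1 + (t + 1) = a) (ha : a ≤ n) :
    (BettiUniverse.primitiveHodge hHD hX D a).hodgeNumber (s + 1 : ℕ) (t + 1 : ℕ) + (BettiUniverse.hodge hHD hX (s + t)).hodgeNumber s t =
      (BettiUniverse.hodge hHD hX a).hodgeNumber (s + 1 : ℕ) (t + 1 : ℕ) := by
  rw [BettiUniverse.hodgeNumber_primitiveHodge_eq_finrank_typePiece_inf hHD hX D (BettiUniverse.realHodgeModel hHD hX) hst]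
  exact D.finrank_typePiece_inf_primitiveClasses_add_hodgeNumber hHD hX (BettiUniverse.realHodgeModel hHD hX) hst ha

/-- **On the edges of the Hodge diamond the primitive Hodge numbers are the Hodge numbers: `h^{0,a}(Pᵃ(X)) = h^{0,a}(Hᵃ(X))`** (`a ≤ n`; every `(0, a)`-class is primitive).
[cite: VoisinHodgeI2002, §6.3.2 proof of Thm. 6.33 and §2.3.1] -/
theorem BettiUniverse.hodgeNumber_primitiveHodge_zero_left (hHD : exists_isReal_hodgeModel) (hX : IsSmoothProjective n X) (D : KaehlerRationalDatum n X) {a : ℕ} (ha : a ≤ n) :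
    (BettiUniverse.primitiveHodge hHD hX D a).hodgeNumber (0 : ℕ) a = (BettiUniverse.hodge hHD hX a).hodgeNumber (0 : ℕ) a := by
  rw [BettiUniverse.hodgeNumber_primitiveHodge_eq_finrank_typePiece_inf hHD hX D (BettiUniverse.realHodgeModel hHD hX) (show 0 + a = a by omega)]
  exact D.finrank_typePiece_inf_primitiveClasses_eq_hodgeNumber_of_fst_eq_zero hHD hX (BettiUniverse.realHodgeModel hHD hX) ha rfl (zero_add a)

/-- **`h^{a,0}(Pᵃ(X)) = h^{a,0}(Hᵃ(X))`** (`a ≤ n`; every holomorphic form is primitive). [cite: VoisinHodgeI2002, §6.3.2 proof of Thm. 6.33 and §2.3.1] -/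
theorem BettiUniverse.hodgeNumber_primitiveHodge_zero_right (hHD : exists_isReal_hodgeModel) (hX : IsSmoothProjective n X) (D : KaehlerRationalDatum n X) {a : ℕ} (ha : a ≤ n) :
    (BettiUniverse.primitiveHodge hHD hX D a).hodgeNumber a (0 : ℕ) = (BettiUniverse.hodge hHD hX a).hodgeNumber a (0 : ℕ) := by
  rw [BettiUniverse.hodgeNumber_primitiveHodge_eq_finrank_typePiece_inf hHD hX D (BettiUniverse.realHodgeModel hHD hX) (show a + 0 = a by omega)]
  exact D.finrank_typePiece_inf_primitiveClasses_eq_hodgeNumber_of_snd_eq_zero hHD hX (BettiUniverse.realHodgeModel hHD hX) ha rfl (add_zero a)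

/-- **`Pᵃ(X) = Hᵃ(X)` in degrees `a ≤ 1`: `h^{s,t}(Pᵃ(X)) = h^{s,t}(Hᵃ(X))`** (`s + t = a ≤ 1`, `a ≤ n`). [cite: VoisinHodgeI2002, §6.2.3 Cor. 6.26] -/
theorem BettiUniverse.hodgeNumber_primitiveHodge_of_le_one (hHD : exists_isReal_hodgeModel) (hX : IsSmoothProjective n X) (D : KaehlerRationalDatum n X) {a s t : ℕ}
    (hst : s + t = a) (ha1 : a ≤ 1) (ha : a ≤ n) :
    (BettiUniverse.primitiveHodge hHD hX D a).hodgeNumber s t = (BettiUniverse.hodge hHD hX a).hodgeNumber s t := by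
  have h := BettiUniverse.hodgeNumber_primitiveHodge_eq_sub hHD hX D ha hst
  rw [if_neg (fun h' ↦ by omega), sub_zero] at h
  exact_mod_cast h

/-- **The primitive Hodge numbers are symmetric: `h^{s,t}(Pᵃ(X)) = h^{t,s}(Pᵃ(X))`** (`s + t = a ≤ n`). [cite: VoisinHodgeI2002, §6.1.3 Cor. 6.12 and §6.3.2 proof of Thm. 6.33] -/
theorem BettiUniverse.hodgeNumber_primitiveHodge_symm (hHD : exists_isReal_hodgeModel) (hX : IsSmoothProjective n X) (D : KaehlerRationalDatum n X) {a : ℕ} (ha : a ≤ n) {s t : ℕ}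
    (hst : s + t = a) :
    (BettiUniverse.primitiveHodge hHD hX D a).hodgeNumber s t = (BettiUniverse.primitiveHodge hHD hX D a).hodgeNumber t s := by
  rw [BettiUniverse.hodgeNumber_primitiveHodge_eq_finrank_typePiece_inf hHD hX D (BettiUniverse.realHodgeModel hHD hX) hst,
    BettiUniverse.hodgeNumber_primitiveHodge_eq_finrank_typePiece_inf hHD hX D (BettiUniverse.realHodgeModel hHD hX) (show t + s = a by omega)]
  exact D.finrank_typePiece_inf_primitiveClasses_symm hHD hX (BettiUniverse.realHodgeModel hHD hX) ha hst (by omega)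

/-- **Degree `2` (`2 ≤ n`): `h^{1,1}(P²(X)) + 1 = h^{1,1}(H²(X))`** (the Kähler class spans the non-primitive `(1,1)`-part). [cite: VoisinHodgeI2002, §6.3.2 proof of Thm. 6.33] -/
theorem BettiUniverse.hodgeNumber_primitiveHodge_two_one_one_add_one (hHD : exists_isReal_hodgeModel) (hX : IsSmoothProjective n X) (D : KaehlerRationalDatum n X) (hn : 2 ≤ n) :
    (BettiUniverse.primitiveHodge hHD hX D 2).hodgeNumber (1 : ℕ) (1 : ℕ) + 1 = (BettiUniverse.hodge hHD hX 2).hodgeNumber (1 : ℕ) (1 : ℕ) := by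
  rw [BettiUniverse.hodgeNumber_primitiveHodge_eq_finrank_typePiece_inf hHD hX D (BettiUniverse.realHodgeModel hHD hX) (show 1 + 1 = 2 by norm_num)]
  exact D.finrank_typePiece_inf_primitiveClasses_one_one_add_one hHD hX (BettiUniverse.realHodgeModel hHD hX) hn

/-- **Degree `2` (`2 ≤ n`): `h^{2,0}(P²(X)) = h^{2,0}(H²(X)) = p_g`** (holomorphic `2`-forms are primitive). [cite: VoisinHodgeI2002, §6.3.2 proof of Thm. 6.33] -/
theorem BettiUniverse.hodgeNumber_primitiveHodge_two_two_zero (hHD : exists_isReal_hodgeModel) (hX : IsSmoothProjective n X) (D : KaehlerRationalDatum n X) (hn : 2 ≤ n) :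
    (BettiUniverse.primitiveHodge hHD hX D 2).hodgeNumber (2 : ℕ) (0 : ℕ) = (BettiUniverse.hodge hHD hX 2).hodgeNumber (2 : ℕ) (0 : ℕ) :=
  BettiUniverse.hodgeNumber_primitiveHodge_zero_right hHD hX D hn

/-- A sub-Hodge structure has no `(p, q)`-component where the ambient Hodge structure has none (as in the tree's `SubHodgeStructure.hodgeNumber_eq_zero_of_piece_eq_bot`, re-proved
here to keep the imports light). [cite: VoisinHodgeI2002, §7.3.1 Def. 7.24] -/
private theorem hodgeNumber_toHodgeStructure_eq_zero_of_piece_eq_bot {W : Type*} [AddCommGroup W] [Module ℚ W] {m : ℤ} {H' : HodgeStructure W m}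
    (S : SubHodgeStructure H') {p q : ℤ} (h : H'.piece p q = ⊥) : S.toHodgeStructure.hodgeNumber p q = 0 := by
  have hbot : S.toHodgeStructure.piece p q = ⊥ := by
    rw [Submodule.eq_bot_iff]
    intro x hx
    rw [S.mem_piece_iff, h, Submodule.mem_bot] at hx
    exact baseChange_injective_of_injective (Submodule.injective_subtype _) (by rw [hx, map_zero])
  rw [hodgeNumber, hbot, finrank_bot]

/-- **`h^{p,q}(Pᵃ(X)) = 0` unless `0 ≤ p`, `0 ≤ q` and `p + q = a`** (the Hodge structure `Hᵃ(X)` is effective of weight `a`). [cite: VoisinHodgeI2002, §7.1.1 Def. 7.4, §7.3.1 Def. 7.24]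
[cite: DeligneHodgeII1971, 1.2.5] -/
theorem BettiUniverse.hodgeNumber_primitiveHodge_eq_zero_of_not (hHD : exists_isReal_hodgeModel) (hX : IsSmoothProjective n X) (D : KaehlerRationalDatum n X) (a : ℕ) {p q : ℤ}
    (h : ¬(0 ≤ p ∧ 0 ≤ q ∧ p + q = a)) : (BettiUniverse.primitiveHodge hHD hX D a).hodgeNumber p q = 0 := by
  rw [BettiUniverse.primitiveHodge_def]
  by_cases hpq : p + q = (a : ℤ)
  · exact hodgeNumber_toHodgeStructure_eq_zero_of_piece_eq_bot _
      (HodgeModel.hodgeStructure_piece_eq_bot_of_neg hX (BettiUniverse.realHodgeModel hHD hX) (BettiUniverse.realHodgeModel_isHodgeSymmetric hHD hX) a (by omega))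
  · exact HodgeStructure.hodgeNumber_eq_zero_of_add_ne _ hpq

end HodgeNumbers

/-! ### §3 Numerical vanishing of the biprimitive Hodge classes: `h^{c,c}(Pⁱ(Y) ⊗ Pʲ(Z)) = Σ h^{a,b}(Pⁱ(Y)) h^{c−a,c−b}(Pʲ(Z)) = 0 ⟹ Hdg^c(Pⁱ(Y) ⊗ Pʲ(Z)) = 0` -/

section Vanishing

variable {m : ℕ} {Y Z : SchemeOver ℂ} [HodgeTensorFacts.{0, 0}]

/-- **If `h^{a,b}(Pⁱ(Y)) · h^{c−a,c−b}(Pʲ(Z)) = 0` for all `(a, b)` (`2c = i + j`), then `Pⁱ(Y) ⊗ Pʲ(Z)` has no non-zero Hodge class of level `c`**: `dim_ℚ Hdg^c ≤ h^{c,c}` and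
`h^{c,c}(Pⁱ ⊗ Pʲ) = Σ_{a,b} h^{a,b}(Pⁱ) h^{c−a,c−b}(Pʲ)` (Deligne's `(V ⊗ W)^{p,q} = ⊕ V^{a,b} ⊗ W^{p−a,q−b}`). [cite: DeligneHodgeII1971, 1.1.12] [cite: VoisinHodgeI2002, §11.3.3 Thm. 11.38, §7.1.1]
[cite: vanGeemen1994HodgeAV, 6.6–6.7] -/
theorem BettiUniverse.hodgeClasses_primitive_tensor_eq_bot_of_forall_hodgeNumber_mul_eq_zero (hHD : exists_isReal_hodgeModel) (hY : IsSmoothProjective m Y)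
    (hZ : IsSmoothProjective n Z) (DY : KaehlerRationalDatum m Y) (DZ : KaehlerRationalDatum n Z) (i j : ℕ) {c : ℤ} (hc : c + c = (i : ℤ) + j)
    (h0 : ∀ a b : ℤ, (BettiUniverse.primitiveHodge hHD hY DY i).hodgeNumber a b * (BettiUniverse.primitiveHodge hHD hZ DZ j).hodgeNumber (c - a) (c - b) = 0) :
    ((BettiUniverse.primitiveHodge hHD hY DY i).tensor (BettiUniverse.primitiveHodge hHD hZ DZ j)).hodgeClasses c = ⊥ := by
  haveI := BettiUniverse.finite hY i
  haveI := BettiUniverse.finite hZ j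
  refine hodgeClasses_eq_bot_of_hodgeNumber_eq_zero _ hc ?_
  rw [hodgeNumber_tensor_holds (BettiUniverse.primitiveHodge hHD hY DY i) (BettiUniverse.primitiveHodge hHD hZ DZ j) c c]
  exact (finsum_congr fun a ↦ (finsum_congr fun b ↦ h0 a b).trans finsum_zero).trans finsum_zero

/-- **Numerical vanishing of the biprimitive Hodge classes of a Künneth piece**: `i + j = 2c`, `i ≤ m`, `j ≤ n`; if `h^{a,b}(Pⁱ(Y)) · h^{c−a,c−b}(Pʲ(Z)) = 0` for all `(a, b)`, then every
biprimitive Hodge class of `Hⁱ(Y) ⊗ Hʲ(Z)` (`(Lʳ ⊗ id) t = 0 = (id ⊗ L^{r'}) t`) vanishes (g38-#7: the biprimitive Hodge classes are the Hodge classes of `Pⁱ(Y) ⊗ Pʲ(Z)`).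
[cite: VoisinHodgeI2002, §6.2.3 Rem. 6.27, §11.3.3 Thm. 11.38, Lemma 11.41 (p. 286)] [cite: DeligneHodgeII1971, 1.1.12] -/
theorem BettiUniverse.eq_zero_of_biprimitive_of_forall_hodgeNumber_mul_eq_zero (hHD : exists_isReal_hodgeModel) (hY : IsSmoothProjective m Y) (hZ : IsSmoothProjective n Z)
    (DY : KaehlerRationalDatum m Y) (DZ : KaehlerRationalDatum n Z) {i j c r r' : ℕ} (hc : i + j = 2 * c) (hi : i ≤ m) (hj : j ≤ n)
    (hr : i + r = m + 1) (hr' : j + r' = n + 1)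
    (h0 : ∀ a b : ℤ, (BettiUniverse.primitiveHodge hHD hY DY i).hodgeNumber a b * (BettiUniverse.primitiveHodge hHD hZ DZ j).hodgeNumber (c - a) (c - b) = 0)
    {t : bettiCohomology Y i ⊗[ℚ] bettiCohomology Z j}
    (ht : t ∈ (BettiUniverse.kunnethSummand hHD hY hZ (2 * c) ⟨(i, j), HasAntidiagonal.mem_antidiagonal.2 hc⟩).hodgeClasses c)
    (h₁ : TensorProduct.map (lefschetzPowTo DY.η r i (i + 2 * r) rfl) LinearMap.id t = 0)
    (h₂ : TensorProduct.map LinearMap.id (lefschetzPowTo DZ.η r' j (j + 2 * r') rfl) t = 0) : t = 0 := by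
  obtain ⟨u, hu, rfl⟩ := BettiUniverse.exists_mapIncl_eq_of_biprimitive hHD hY hZ DY DZ hc hi hj hr hr' ht h₁ h₂
  rw [BettiUniverse.hodgeClasses_primitive_tensor_eq_bot_of_forall_hodgeNumber_mul_eq_zero hHD hY hZ DY DZ i j (by omega) h0,
    Submodule.mem_bot] at hu
  rw [hu, map_zero]

end Vanishing

/-! ### §4 A worked shape: `HC(S × T)` for a surface and a threefold from `q(S) · h^{2,1}_prim(T) = 0` and the count on `P²(S) ⊗ P²(T)` -/

section SurfaceThreefold

variable {S T : SchemeOver ℂ} [HodgeTensorFacts.{0, 0}]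

omit [HodgeTensorFacts.{0, 0}] in
/-- `Lʳ : Hᵏ(X;ℚ) → H^{k+2r}(X;ℚ)` is `0` above the top degree. [cite: HatcherAT2002, §3.3 Thm. 3.26] -/
private theorem lefschetzPowTo_eq_zero_of_lt'' {m : ℕ} {X : SchemeOver ℂ} (hX : IsSmoothProjective m X) (κ : bettiCohomology X 2) {r k l : ℕ}
    (h : k + 2 * r = l) (hl : 2 * m < l) : lefschetzPowTo κ r k l h = 0 := by
  haveI := BettiUniverse.finite hX l
  have h0 := (finrank_zero_iff_forall_zero (K := ℚ) (V := ↥(bettiCohomology X l))).1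
    (BettiUniverse.finrank_bettiCohomology_eq_zero_of_lt hX hl)
  exact LinearMap.ext fun x ↦ h0 _

/-- **`HC(S × T)` for a smooth projective surface `S` and threefold `T` with `q(S) · h^{2,1}_prim(T) = 0` and `dim_ℚ Hom_HS(P²(S), P²(T)) ≤ ρ₀(S) ρ₀(T)`** (`q(S) = h^{1,0}(S)`,
`h^{2,1}_prim(T) = h^{2,1}(P³(T)) = h^{2,1}(T) − q(T)`, `ρ₀ = dim_ℚ Hdg¹(P²)`): the piece `H¹(S) ⊗ H³(T)` reduces to `H¹(S) ⊗ P³(T)`, whose `(2,2)`-Hodge number is `2 q(S) h^{2,1}_prim(T)`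
(§3), the piece `H² ⊗ H²` to `P²(S) ⊗ P²(T)`, settled by counting (g38-#8), the remaining pieces by hard Lefschetz and `HC` in dimension `≤ 3` (g38-#5/#6).
[cite: VoisinHodgeI2002, §6.2.3 Cor. 6.26, Rem. 6.27, §11.3.3 Thm. 11.38–11.40, Lemma 11.41 and p. 287, §11.3.1 Thm. 11.30] [cite: DeligneHodgeII1971, 1.1.12] [cite: VoisinHodgeII2003, §9.2.4 Prop. 9.20] [cite: Deligne2000, §1] -/
theorem BettiUniverse.hodgeConjectureFor_surface_tensor_threefold_of_hodgeNumber_of_finrank_hom_le (hHD : exists_isReal_hodgeModel) (hS : IsSmoothProjective 2 S)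
    (hT : IsSmoothProjective 3 T) (hST : IsSmoothProjective d (S ⊗ T)) (D : KaehlerRationalDatum 2 S) (D' : KaehlerRationalDatum 3 T)
    (h13 : (BettiUniverse.hodge hHD hS 1).hodgeNumber (1 : ℕ) (0 : ℕ) = 0 ∨ (BettiUniverse.primitiveHodge hHD hT D' 3).hodgeNumber (2 : ℕ) (1 : ℕ) = 0)
    (h22 : Module.finrank ℚ (HodgeStructure.Hom (BettiUniverse.primitiveHodge hHD hS D (2 * 1))
        (((BettiUniverse.primitiveHodge hHD hT D' (2 * 1)).tateTwist (((1 : ℕ) : ℤ) - (1 : ℕ))).cast (by norm_num))) ≤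
      Module.finrank ℚ ↥((BettiUniverse.primitiveHodge hHD hS D (2 * 1)).hodgeClasses (1 : ℕ)) *
        Module.finrank ℚ ↥((BettiUniverse.primitiveHodge hHD hT D' (2 * 1)).hodgeClasses (1 : ℕ))) :
    HodgeConjectureFor d (S ⊗ T) := by
  refine BettiUniverse.hodgeConjectureFor_surface_tensor_of_primitive_kunneth_pieces hHD hS hT hST D D' (hodgeConjectureFor_of_dim_le_three_holds (by norm_num) hT)
    (fun c j r' hj h3j hj3 hr' t ht h₂ ↦ ?_) (fun c j r' hj h2j hj3 hr' t ht h₁ h₂ ↦ ?_)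
  · -- the piece `H¹(S) ⊗ H³(T)`: `j = 3`, `c = 2`, `r' = 1`
    obtain rfl : j = 3 := by omega
    obtain rfl : c = 2 := by omega
    obtain rfl : r' = 1 := by omega
    have h₁ : TensorProduct.map (lefschetzPowTo D.η 2 1 (1 + 2 * 2) rfl) LinearMap.id t = 0 := by
      rw [lefschetzPowTo_eq_zero_of_lt'' hS D.η rfl (by norm_num), TensorProduct.map_zero_left, LinearMap.zero_apply]
    have h0 : ∀ a b : ℤ, (BettiUniverse.primitiveHodge hHD hS D 1).hodgeNumber a b * (BettiUniverse.primitiveHodge hHD hT D' 3).hodgeNumber (2 - a) (2 - b) = 0 := by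
      intro a b
      by_cases hab : 0 ≤ a ∧ 0 ≤ b ∧ a + b = (1 : ℕ)
      · obtain ⟨ha, hb, hab⟩ := hab
        obtain ⟨a, rfl⟩ := Int.eq_ofNat_of_zero_le ha
        obtain ⟨b, rfl⟩ := Int.eq_ofNat_of_zero_le hb
        have hab' : a + b = 1 := by exact_mod_cast hab
        rcases Nat.eq_zero_or_pos a with rfl | ha0
        · obtain rfl : b = 1 := by omega
          -- `h^{0,1}(H¹(S)) · h^{2,1}(P³(T))`
          rw [show (2 : ℤ) - ((0 : ℕ) : ℤ) = ((2 : ℕ) : ℤ) by norm_num, show (2 : ℤ) - ((1 : ℕ) : ℤ) = ((1 : ℕ) : ℤ) by norm_num,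
            BettiUniverse.hodgeNumber_primitiveHodge_of_le_one hHD hS D (show 0 + 1 = 1 by norm_num) le_rfl (by norm_num), BettiUniverse.hodgeNumber_hodge_symm]
          rcases h13 with h | h
          · rw [h, zero_mul]
          · rw [h, mul_zero]
        · obtain rfl : a = 1 := by omega
          obtain rfl : b = 0 := by omega
          -- `h^{1,0}(H¹(S)) · h^{1,2}(P³(T))`
          rw [show (2 : ℤ) - ((1 : ℕ) : ℤ) = ((1 : ℕ) : ℤ) by norm_num, show (2 : ℤ) - ((0 : ℕ) : ℤ) = ((2 : ℕ) : ℤ) by norm_num,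
            BettiUniverse.hodgeNumber_primitiveHodge_of_le_one hHD hS D (show 1 + 0 = 1 by norm_num) le_rfl (by norm_num),
            BettiUniverse.hodgeNumber_primitiveHodge_symm hHD hT D' le_rfl (show 1 + 2 = 3 by norm_num)]
          rcases h13 with h | h
          · rw [h, zero_mul]
          · rw [h, mul_zero]
      · rw [BettiUniverse.hodgeNumber_primitiveHodge_eq_zero_of_not hHD hS D 1 hab, zero_mul]
    rw [BettiUniverse.eq_zero_of_biprimitive_of_forall_hodgeNumber_mul_eq_zero hHD hS hT D D' (i := 1) (j := 3) (c := 2) (r := 2) (r' := 1)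
      (by norm_num) (by norm_num) le_rfl (by norm_num) (by norm_num) h0 ht h₁ h₂, map_zero, map_zero]
    exact Submodule.zero_mem _
  · -- the piece `H²(S) ⊗ H²(T)`: `j = 2`, `c = 2`, `r' = 2`; counting on `P²(S) ⊗ P²(T)`
    obtain rfl : j = 2 := by omega
    obtain rfl : c = 2 := by omega
    obtain rfl : r' = 2 := by omega
    exact BettiUniverse.ofRatClass_crossMap_mem_algebraicClasses_of_biprimitive_of_finrank_hom_le hHD hS hT D D' (a := 1) (b := 1) (r := 1) (r' := 2)
      (by norm_num) (by norm_num) (by norm_num) (by norm_num)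
      (fun y hy ↦ BettiUniverse.ofRatClass_mem_algebraicClasses_of_mem_hodgeClasses_primitiveHodge_two hHD hS D y hy)
      (fun z hz ↦ BettiUniverse.ofRatClass_mem_algebraicClasses_of_mem_hodgeClasses_primitiveHodge_two hHD hT D' z hz) h22 ht h₁ h₂

end SurfaceThreefold

/-! ### §5 `Hom_HS` between primitive parts vanishes numerically; `HC(T × T')` for two threefolds from primitive Hodge numbers and the count on `P² ⊗ P²` -/

section Numerical

variable {m : ℕ} {Y Z T T' : SchemeOver ℂ} [HodgeTensorFacts.{0, 0}]

/-- **`Hom_HS(Pⁱ(Y), Pʲ(Z)(s)) = 0` as soon as `h^{a,b}(Pⁱ(Y)) · h^{i+s−a, i+s−b}(Pʲ(Z)) = 0` for all `(a, b)`** (`j = i + 2s`): Lemma 11.41 for the polarisable `Pⁱ(Y)` (g38-#7) and the numerical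
vanishing of `Hdg^{i+s}(Pⁱ(Y) ⊗ Pʲ(Z))` (§3). [cite: VoisinHodgeI2002, §11.3.3 Lemma 11.41 (p. 286), §7.1.2 Lemma 7.26] [cite: DeligneHodgeII1971, 1.1.12] -/
theorem BettiUniverse.subsingleton_hom_primitive_tateTwist_of_forall_hodgeNumber_mul_eq_zero (hHD : exists_isReal_hodgeModel) (hY : IsSmoothProjective m Y) (hZ : IsSmoothProjective n Z)
    (DY : KaehlerRationalDatum m Y) (DZ : KaehlerRationalDatum n Z) (i j : ℕ) {s : ℤ} (hs : (j : ℤ) - 2 * s = i)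
    (h0 : ∀ a b : ℤ, (BettiUniverse.primitiveHodge hHD hY DY i).hodgeNumber a b * (BettiUniverse.primitiveHodge hHD hZ DZ j).hodgeNumber ((i : ℤ) + s - a) ((i : ℤ) + s - b) = 0) :
    Subsingleton (HodgeStructure.Hom (BettiUniverse.primitiveHodge hHD hY DY i) (((BettiUniverse.primitiveHodge hHD hZ DZ j).tateTwist s).cast hs)) :=
  (BettiUniverse.hodgeClasses_primitive_tensor_eq_bot_iff_subsingleton_hom_tateTwist hHD hY hZ DY DZ i j hs).1
    (BettiUniverse.hodgeClasses_primitive_tensor_eq_bot_of_forall_hodgeNumber_mul_eq_zero hHD hY hZ DY DZ i j (by omega) h0)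

omit [HodgeTensorFacts.{0, 0}] in
/-- The `(2,2)`-Hodge number of `H¹(Y) ⊗ P³(Z)` term by term: `h^{a,b}(H¹(Y)) · h^{2−a,2−b}(P³(Z)) = 0` for all `(a, b)` as soon as `q(Y) = 0` or `h^{2,1}(P³(Z)) = 0` (`1 ≤ dim Y`, `3 ≤ dim Z`).
[cite: VoisinHodgeI2002, §6.3.2 proof of Thm. 6.33, §6.1.3 Cor. 6.12] -/
private theorem forall_hodgeNumber_one_mul_three_eq_zero (hHD : exists_isReal_hodgeModel) (hY : IsSmoothProjective m Y) (hZ : IsSmoothProjective n Z) (DY : KaehlerRationalDatum m Y)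
    (DZ : KaehlerRationalDatum n Z) (hm : 1 ≤ m) (hn : 3 ≤ n)
    (h : (BettiUniverse.hodge hHD hY 1).hodgeNumber (1 : ℕ) (0 : ℕ) = 0 ∨ (BettiUniverse.primitiveHodge hHD hZ DZ 3).hodgeNumber (2 : ℕ) (1 : ℕ) = 0) (a b : ℤ) :
    (BettiUniverse.primitiveHodge hHD hY DY 1).hodgeNumber a b * (BettiUniverse.primitiveHodge hHD hZ DZ 3).hodgeNumber (2 - a) (2 - b) = 0 := by
  by_cases hab : 0 ≤ a ∧ 0 ≤ b ∧ a + b = (1 : ℕ)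
  · obtain ⟨ha, hb, hab⟩ := hab
    obtain ⟨a, rfl⟩ := Int.eq_ofNat_of_zero_le ha
    obtain ⟨b, rfl⟩ := Int.eq_ofNat_of_zero_le hb
    have hab' : a + b = 1 := by exact_mod_cast hab
    rcases Nat.eq_zero_or_pos a with rfl | ha0
    · obtain rfl : b = 1 := by omega
      rw [show (2 : ℤ) - ((0 : ℕ) : ℤ) = ((2 : ℕ) : ℤ) by norm_num, show (2 : ℤ) - ((1 : ℕ) : ℤ) = ((1 : ℕ) : ℤ) by norm_num,
        BettiUniverse.hodgeNumber_primitiveHodge_of_le_one hHD hY DY (show 0 + 1 = 1 by norm_num) le_rfl hm, BettiUniverse.hodgeNumber_hodge_symm]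
      rcases h with h | h
      · rw [h, zero_mul]
      · rw [h, mul_zero]
    · obtain rfl : a = 1 := by omega
      obtain rfl : b = 0 := by omega
      rw [show (2 : ℤ) - ((1 : ℕ) : ℤ) = ((1 : ℕ) : ℤ) by norm_num, show (2 : ℤ) - ((0 : ℕ) : ℤ) = ((2 : ℕ) : ℤ) by norm_num,
        BettiUniverse.hodgeNumber_primitiveHodge_of_le_one hHD hY DY (show 1 + 0 = 1 by norm_num) le_rfl hm,
        BettiUniverse.hodgeNumber_primitiveHodge_symm hHD hZ DZ hn (show 1 + 2 = 3 by norm_num)]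
      rcases h with h | h
      · rw [h, zero_mul]
      · rw [h, mul_zero]
  · rw [BettiUniverse.hodgeNumber_primitiveHodge_eq_zero_of_not hHD hY DY 1 hab, zero_mul]

omit [HodgeTensorFacts.{0, 0}] in
/-- The `(3,3)`-Hodge number of `P³(T) ⊗ P³(T')` term by term: `h^{a,b}(P³(T)) · h^{3−a,3−b}(P³(T')) = 0` for all `(a, b)` as soon as `h^{3,0}(T) h^{3,0}(T') = 0` and
`h^{2,1}(P³(T)) h^{2,1}(P³(T')) = 0` (`3 ≤ dim T, dim T'`). [cite: VoisinHodgeI2002, §6.3.2 proof of Thm. 6.33, §6.1.3 Cor. 6.12] -/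
private theorem forall_hodgeNumber_three_mul_three_eq_zero (hHD : exists_isReal_hodgeModel) (hY : IsSmoothProjective m Y) (hZ : IsSmoothProjective n Z) (DY : KaehlerRationalDatum m Y)
    (DZ : KaehlerRationalDatum n Z) (hm : 3 ≤ m) (hn : 3 ≤ n)
    (h30 : (BettiUniverse.hodge hHD hY 3).hodgeNumber (3 : ℕ) (0 : ℕ) = 0 ∨ (BettiUniverse.hodge hHD hZ 3).hodgeNumber (3 : ℕ) (0 : ℕ) = 0)
    (h21 : (BettiUniverse.primitiveHodge hHD hY DY 3).hodgeNumber (2 : ℕ) (1 : ℕ) = 0 ∨ (BettiUniverse.primitiveHodge hHD hZ DZ 3).hodgeNumber (2 : ℕ) (1 : ℕ) = 0) (a b : ℤ) :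
    (BettiUniverse.primitiveHodge hHD hY DY 3).hodgeNumber a b * (BettiUniverse.primitiveHodge hHD hZ DZ 3).hodgeNumber (3 - a) (3 - b) = 0 := by
  by_cases hab : 0 ≤ a ∧ 0 ≤ b ∧ a + b = (3 : ℕ)
  · obtain ⟨ha, hb, hab⟩ := hab
    obtain ⟨a, rfl⟩ := Int.eq_ofNat_of_zero_le ha
    obtain ⟨b, rfl⟩ := Int.eq_ofNat_of_zero_le hb
    have hab' : a + b = 3 := by exact_mod_cast hab
    have e : ∀ k : ℕ, k ≤ 3 → (3 : ℤ) - (k : ℤ) = ((3 - k : ℕ) : ℤ) := fun k hk ↦ by omega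
    rw [e a (by omega), e b (by omega)]
    rcases (show a = 0 ∨ a = 1 ∨ a = 2 ∨ a = 3 by omega) with rfl | rfl | rfl | rfl
    · obtain rfl : b = 3 := by omega
      -- `h^{0,3}(P³T) · h^{3,0}(P³T')`
      rw [BettiUniverse.hodgeNumber_primitiveHodge_zero_left hHD hY DY hm, BettiUniverse.hodgeNumber_hodge_symm,
        show (3 - 0 : ℕ) = 3 from rfl, show (3 - 3 : ℕ) = 0 from rfl, BettiUniverse.hodgeNumber_primitiveHodge_zero_right hHD hZ DZ hn]
      rcases h30 with h | h
      · rw [h, zero_mul]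
      · rw [h, mul_zero]
    · obtain rfl : b = 2 := by omega
      -- `h^{1,2}(P³T) · h^{2,1}(P³T')`
      rw [BettiUniverse.hodgeNumber_primitiveHodge_symm hHD hY DY hm (show 1 + 2 = 3 by norm_num), show (3 - 1 : ℕ) = 2 from rfl, show (3 - 2 : ℕ) = 1 from rfl]
      rcases h21 with h | h
      · rw [h, zero_mul]
      · rw [h, mul_zero]
    · obtain rfl : b = 1 := by omega
      -- `h^{2,1}(P³T) · h^{1,2}(P³T')`
      rw [show (3 - 2 : ℕ) = 1 from rfl, show (3 - 1 : ℕ) = 2 from rfl, BettiUniverse.hodgeNumber_primitiveHodge_symm hHD hZ DZ hn (show 1 + 2 = 3 by norm_num)]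
      rcases h21 with h | h
      · rw [h, zero_mul]
      · rw [h, mul_zero]
    · obtain rfl : b = 0 := by omega
      -- `h^{3,0}(P³T) · h^{0,3}(P³T')`
      rw [BettiUniverse.hodgeNumber_primitiveHodge_zero_right hHD hY DY hm, show (3 - 3 : ℕ) = 0 from rfl, show (3 - 0 : ℕ) = 3 from rfl,
        BettiUniverse.hodgeNumber_primitiveHodge_zero_left hHD hZ DZ hn, BettiUniverse.hodgeNumber_hodge_symm hHD hZ]
      rcases h30 with h | h
      · rw [h, zero_mul]
      · rw [h, mul_zero]
  · rw [BettiUniverse.hodgeNumber_primitiveHodge_eq_zero_of_not hHD hY DY 3 hab, zero_mul]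

/-- **`HC(T × T')` for two smooth projective threefolds from primitive Hodge numbers and one count**: if `q(T) · h^{2,1}_prim(T') = 0`, `q(T') · h^{2,1}_prim(T) = 0`,
`h^{3,0}(T) · h^{3,0}(T') = 0`, `h^{2,1}_prim(T) · h^{2,1}_prim(T') = 0` (`q = h^{1,0}`, `h^{2,1}_prim = h^{2,1}(P³) = h^{2,1} − q`), and `dim_ℚ Hom_HS(P²(T), P²(T')) ≤ ρ₀(T) ρ₀(T')`
(`ρ₀ = dim_ℚ Hdg¹(P²)`), then `HC(T ⊗ T')`: the three `Hom_HS` of g38-#8's criterion vanish numerically (§3, Lemma 11.41), the piece `H² ⊗ H²` is counted on `P²(T) ⊗ P²(T')`.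
[cite: VoisinHodgeI2002, §6.2.3 Cor. 6.26, Rem. 6.27, §6.3.2 proof of Thm. 6.33, §11.3.3 Thm. 11.38–11.40, Lemma 11.41 and p. 287, §11.3.1 Thm. 11.30] [cite: DeligneHodgeII1971, 1.1.12]
[cite: VoisinHodgeII2003, §9.2.4 Prop. 9.20] [cite: Deligne2000, §1] -/
theorem BettiUniverse.hodgeConjectureFor_tensor_threefolds_of_hodgeNumber_of_finrank_hom_le (hHD : exists_isReal_hodgeModel) (hT : IsSmoothProjective 3 T)
    (hT' : IsSmoothProjective 3 T') (hTT' : IsSmoothProjective 6 (T ⊗ T')) (D : KaehlerRationalDatum 3 T) (D' : KaehlerRationalDatum 3 T')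
    (h13 : (BettiUniverse.hodge hHD hT 1).hodgeNumber (1 : ℕ) (0 : ℕ) = 0 ∨ (BettiUniverse.primitiveHodge hHD hT' D' 3).hodgeNumber (2 : ℕ) (1 : ℕ) = 0)
    (h31 : (BettiUniverse.hodge hHD hT' 1).hodgeNumber (1 : ℕ) (0 : ℕ) = 0 ∨ (BettiUniverse.primitiveHodge hHD hT D 3).hodgeNumber (2 : ℕ) (1 : ℕ) = 0)
    (h30 : (BettiUniverse.hodge hHD hT 3).hodgeNumber (3 : ℕ) (0 : ℕ) = 0 ∨ (BettiUniverse.hodge hHD hT' 3).hodgeNumber (3 : ℕ) (0 : ℕ) = 0)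
    (h21 : (BettiUniverse.primitiveHodge hHD hT D 3).hodgeNumber (2 : ℕ) (1 : ℕ) = 0 ∨ (BettiUniverse.primitiveHodge hHD hT' D' 3).hodgeNumber (2 : ℕ) (1 : ℕ) = 0)
    (h22 : Module.finrank ℚ (HodgeStructure.Hom (BettiUniverse.primitiveHodge hHD hT D (2 * 1))
        (((BettiUniverse.primitiveHodge hHD hT' D' (2 * 1)).tateTwist (((1 : ℕ) : ℤ) - (1 : ℕ))).cast (by norm_num))) ≤
      Module.finrank ℚ ↥((BettiUniverse.primitiveHodge hHD hT D (2 * 1)).hodgeClasses (1 : ℕ)) *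
        Module.finrank ℚ ↥((BettiUniverse.primitiveHodge hHD hT' D' (2 * 1)).hodgeClasses (1 : ℕ))) :
    HodgeConjectureFor 6 (T ⊗ T') := by
  refine BettiUniverse.hodgeConjectureFor_tensor_threefolds_of_hom_primitive hHD hT hT' hTT' D D' ?_ ?_ ?_ h22
  · -- `Hom_HS(H¹(T), P³(T')(1)) = 0`: level `c = 1 + 1 = 2`
    refine BettiUniverse.subsingleton_hom_primitive_tateTwist_of_forall_hodgeNumber_mul_eq_zero hHD hT hT' D D' 1 3 (by norm_num) fun a b ↦ ?_
    rw [show ((1 : ℕ) : ℤ) + 1 - a = 2 - a by ring, show ((1 : ℕ) : ℤ) + 1 - b = 2 - b by ring]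
    exact forall_hodgeNumber_one_mul_three_eq_zero hHD hT hT' D D' (by norm_num) le_rfl h13 a b
  · -- `Hom_HS(P³(T), H¹(T')(−1)) = 0`: level `c = 3 − 1 = 2`, the mirror computation
    refine BettiUniverse.subsingleton_hom_primitive_tateTwist_of_forall_hodgeNumber_mul_eq_zero hHD hT hT' D D' 3 1 (by norm_num) fun a b ↦ ?_
    have h := forall_hodgeNumber_one_mul_three_eq_zero hHD hT' hT D' D (by norm_num) le_rfl h31 (2 - a) (2 - b)
    rw [sub_sub_cancel, sub_sub_cancel, mul_comm] at h
    rw [show ((3 : ℕ) : ℤ) + -1 - a = 2 - a by ring, show ((3 : ℕ) : ℤ) + -1 - b = 2 - b by ring]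
    exact h
  · -- `Hom_HS(P³(T), P³(T')) = 0`: level `c = 3`
    refine BettiUniverse.subsingleton_hom_primitive_tateTwist_of_forall_hodgeNumber_mul_eq_zero hHD hT hT' D D' 3 3 (by norm_num) fun a b ↦ ?_
    rw [show ((3 : ℕ) : ℤ) + 0 - a = 3 - a by ring, show ((3 : ℕ) : ℤ) + 0 - b = 3 - b by ring]
    exact forall_hodgeNumber_three_mul_three_eq_zero hHD hT hT' D D' le_rfl le_rfl h30 h21 a b

end Numerical

end Literature.AlgebraicGeometry.HodgeTheory

end
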